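import Literature.AlgebraicGeometry.Frobenioids.RlfStructureWeak
import Literature.AlgebraicGeometry.Frobenioids.ModelFrobenioidPreFrobenioid
import Literature.AnabelianGeometry.EtaleTheta.RealificationOrderWeak
import Literature.AnabelianGeometry.EtaleTheta.DivisorMonoids
import HarnessLib

/-!
# [EtTh] §3 / [FrdI] Def. 2.4 (i), weak form: effectivity is detected in the realification of a WEAKLY
# perf-factorial monoid (PROVED)

Proof-only file (theorems only, no definitions), the weak twin of `RlfEffective.exists_eq_of`
(`Discharge/Sec3Prop34CnstOfRlfZ.lean`, abc-iut-L2-t3): for a WEAKLY perf-factorial monoid `M`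
(`Frobenioids.IsPerfFactorialWeak`: [FrdI] Def. 2.4 (i) (a)(b)(c) + (d_ord) + (d_res), abc-iut-L1-t2 — the
notion that holds for the divisor monoids `Φ₀(Y)` of [EtTh] §3 at tempered coverings with infinitely many
special-fibre components, cell finding F-L2d2-1), an element of `M^gp` whose image in `(M^rlf)^gp` is
EFFECTIVE is effective.  S. Mochizuki, *The étale theta function …*, Publ. RIMS **45** (2009) [EtTh],
Prop. 3.4 (ii) p.74 / Def. 3.6 (i) p.76 [cite: MochizukiEtTh2009, Prop 3.4 (ii) p.74]; [FrdI] Def. 2.4 (i)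
p.48 [cite: MochizukiFrdI2008, Def. 2.4(i) p.48].  Ingredients: `M^rlf` integral for weak `M`
(`IsPerfFactorialWeak.Rlf.isIntegral`, abc-iut-L2-d2), the weak order embedding `M^pf ↪ M^rlf`
(`RlfCoordWeak.toRealification_dvd_iff`, from (d_ord) — no cofinality needed; `RlfCoordWeak.isMonoprime_pfAt`),
injectivity of `M → M^pf` and saturatedness of the divisorial `M` ([FrdI] §0).  USE: the transport
`Prop34 ∧ Prop34Cnst₀ ⇒ Prop34Cnst` for the weak-vocabulary constructor `RealifiedDivisorMonoids.ofRlfZWeak`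
(abc-iut-L6-t12) is then the same 20 lines as `Prop34Cnst.ofRlfZ`.  HONEST FRAMING: refereed pre-IUT material;
nothing here bears on [IUTchIII] Cor. 3.12; here PROVED.
-/

namespace Literature.AnabelianGeometry.EtaleTheta

open Literature.AlgebraicGeometry.Frobenioids

namespace RlfEffective

universe w

variable {M : Type w} [CommMonoid M]

/-- **An element of `M^gp` whose image in `(M^rlf)^gp` is effective is effective — weak form**: for a
WEAKLY perf-factorial monoid `M`, if `g ∈ M^gp` maps to (the image of) `x ∈ M^rlf` under `M^gp → (M^rlf)^gp`,
then `g = [x₀]` for some `x₀ ∈ M`, and `x` is the image of `x₀`.  Proof as in the printed-perf-factorial case: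
`g = a/c`; `x · ι(c) = ι(a)` in the integral `M^rlf`; `c ≤ a` in `M^pf` by the order embedding (d_ord); `a = c·d`
with `d^n ∈ M`; `g^n ∈ M`, so `g ∈ M` by saturatedness. [cite: MochizukiFrdI2008, Def. 2.4(i) p.48] -/
theorem exists_eq_of_weak (hP : IsPerfFactorialWeak M) (g : Algebra.GrothendieckGroup M) (x : hP.Rlf)
    (h : gpMap (hP.toRealification.comp (Perfection.of M)) g = Algebra.GrothendieckGroup.of x) :
    ∃ x₀ : M, g = Algebra.GrothendieckGroup.of x₀ ∧ x = hP.toRealification (Perfection.of M x₀) := by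
  -- `g = a / c`
  obtain ⟨a, c, hac⟩ := gp_exists_mul_of_eq_of g
  have hint : Function.Injective (Algebra.GrothendieckGroup.of (M := hP.Rlf)) :=
    (IsPerfFactorialWeak.Rlf.isIntegral hP).injective_of
  -- `x · ι(c) = ι(a)` in `M^rlf`
  have h1 : Algebra.GrothendieckGroup.of x *
      Algebra.GrothendieckGroup.of ((hP.toRealification.comp (Perfection.of M)) c) =
        Algebra.GrothendieckGroup.of ((hP.toRealification.comp (Perfection.of M)) a) := by
    have h' := congrArg (gpMap (hP.toRealification.comp (Perfection.of M))) hac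
    rw [map_mul, gpMap_of, gpMap_of, h] at h'
    exact h'
  have h2 : x * (hP.toRealification.comp (Perfection.of M)) c =
      (hP.toRealification.comp (Perfection.of M)) a :=
    hint (by rw [map_mul]; exact h1)
  -- `ι(c) ≤ ι(a)` in `M^rlf`, hence `c ≤ a` in `M^pf` (order embedding from (d_ord))
  have h3 : hP.toRealification (Perfection.of M c) ∣ hP.toRealification (Perfection.of M a) :=
    ⟨x, by rw [mul_comm]; exact h2.symm⟩
  have h4 : Perfection.of M c ∣ Perfection.of M a :=
    (RlfCoordWeak.toRealification_dvd_iff hP (fun 𝔮 => RlfCoordWeak.isMonoprime_pfAt hP 𝔮) _ _).mp h3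
  obtain ⟨d, hd⟩ := h4
  obtain ⟨⟨m, n⟩, hmn⟩ := Perfection.mk_surjective d
  simp only at hmn
  subst hmn
  -- `a^n = c^n · m` in `M`
  have hofinj : Function.Injective (Perfection.of M) :=
    of_injective_of_isSharp_isIntegral_isSaturated hP.isDivisorial.isSharp
      hP.isDivisorial.isPreDivisorial.isIntegral hP.isDivisorial.isPreDivisorial.isSaturated
  have h5 : a ^ (n : ℕ) = c ^ (n : ℕ) * m := by
    apply hofinj
    rw [map_pow, hd, mul_pow, Perfection.mk_pow_self, map_mul, map_pow]
  -- `g^n = [m]` in `M^gp`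
  have h6 : g ^ (n : ℕ) = Algebra.GrothendieckGroup.of m := by
    have h' := congrArg (fun y => y ^ (n : ℕ)) hac
    rw [mul_pow, ← map_pow, ← map_pow, h5, map_mul,
      mul_comm (Algebra.GrothendieckGroup.of (c ^ (n : ℕ)))] at h'
    exact mul_right_cancel h'
  -- `M` saturated
  obtain ⟨x₀, hx₀⟩ :=
    hP.isDivisorial.isPreDivisorial.isSaturated.mem_range_of_pow_mem_range g n n.pos ⟨m, h6.symm⟩
  refine ⟨x₀, hx₀.symm, hint ?_⟩
  rw [← h, ← hx₀, gpMap_of]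
  rfl

end RlfEffective

end Literature.AnabelianGeometry.EtaleTheta
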